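import Summits.SmoothPoincare4.SmoothPoincare4.Theorems.CongruenceShadowsShadowApproximationStubLayerStepZeroOneTwists
import HarnessLib

/-!
# Helper IV (commutator calculus in degree three) for stub `stub_layerStepZeroTwo` of line
`nilpotent-genus-class`, crux `CongruenceShadows.ShadowApproximation` (item stmt-SmoothPoincare4-14595)

General group theory (`γₙ₊₁ = (⊤ : Subgroup G).lowerCentralSeries n`, `𝒥ₖ = {ψ ∈ Aut G | ψ(s)s⁻¹ ∈ γₖ₊₁}`)
and the Magnus–Witt symbols `θₖ` of `F₃` (hypotheses on a variable `θ`, as in the sibling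
`…StubLayerStepZeroOneTwists`), one degree above the level-two calculus of the `(0,1)` files:
* `jkm_*` — the RESTRICTED JOHNSON CALCULUS: `ψ ∈ 𝒥ₖ` acts on `γₘ₊₁` with values in `γₖ₊ₘ₊₁`, and
  `w ↦ ψ(w)w⁻¹ (mod γₖ₊ₘ₊₂)` is a homomorphism on `γₘ₊₁` killing `γₘ₊₂` (products, inverses, powers, congruence);
* `comm_johnson` — THE COMMUTATOR CONGRUENCE: for `x ∈ 𝒥₁`, `U ∈ 𝒥₂` the commutator `V = x U x⁻¹ U⁻¹` (in `Aut G`)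
  lies in `𝒥₃` and `V(s)s⁻¹ ≡ x(u)u⁻¹ · (U(ξ)ξ⁻¹)⁻¹ (mod γ₅)` with `u = U(s)s⁻¹`, `ξ = x(s)s⁻¹`
  (the group form of `τ₃[x,U] = [τ₁ x, τ₂ U]`);
* `theta_expand` — THE DERIVATION RULE for the symbols: `θ(⁅f c, e p⁆ ⁅c,p⁆⁻¹) = ⁅θ c, θ e⁆ + ⁅θ f, θ p⁆` one filtration
  step up, whence `θ₃ ∘ π` of `x(⁅⁅P,Q⁆,R⁆)⁅⁅P,Q⁆,R⁆⁻¹` (`theta3_x_comm_comm`) and of `U(⁅A,B⁆)⁅A,B⁆⁻¹`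
  (`theta3_U_comm`) in terms of the lower data.
No definitions, no notations.
-/

set_option linter.dupNamespace false

noncomputable section

open Subgroup Literature.Topology.FourManifolds Literature.Algebra.Lie Multiplicative
open Summit.SmoothPoincare4.SmoothPoincare4.Theorems.NilpotentShadowsStandard.SaturatedTorsorDescent
open Literature.GroupTheory.CombinatorialGroupTheory (commutator_mem_lcs_of_eq commutator_mem_lcs commutator_mem_lcs_succ
  commutator_mem_lcs_succ')
open scoped commutatorElement

namespace Summit.SmoothPoincare4.SmoothPoincare4.Theorems.ShadowApproximation.NilpotentGenusClass

namespace LayerZeroTwo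

open LayerZeroOne

/-! ## The restricted Johnson calculus: `𝒥ₖ` acting on `γₘ₊₁` modulo `γₖ₊ₘ₊₂` -/

section General

variable {G : Type*} [Group G] {k : ℕ}

/-- Conjugation is trivial on `γₙ₊₁ / γₙ₊₂`. [folklore] -/
theorem conj_quot_eq {n : ℕ} (g : G) {z : G} (hz : z ∈ (⊤ : Subgroup G).lowerCentralSeries n) :
    ((g * z * g⁻¹ : G) : G ⧸ (⊤ : Subgroup G).lowerCentralSeries (n + 1)) = z := by
  rw [← mul_inv_mem_iff_quot, ← commutatorElement_def]
  exact commutator_mem_lcs_succ' g hz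

/-- `ψ ∈ 𝒥ₖ` moves `γₘ₊₁` within `γₖ₊ₘ₊₁`. [folklore] -/
theorem jkm_mem (ψ : G ≃* G) (hψ : ∀ s, ψ s * s⁻¹ ∈ (⊤ : Subgroup G).lowerCentralSeries k) (m : ℕ) {w : G}
    (hw : w ∈ (⊤ : Subgroup G).lowerCentralSeries m) : ψ w * w⁻¹ ∈ (⊤ : Subgroup G).lowerCentralSeries (k + m) :=
  jk_lcs ψ.toMonoidHom hψ m w hw

/-- **Restricted Johnson map is multiplicative**: for `w₁, w₂ ∈ γₘ₊₁`,
`ψ(w₁w₂)(w₁w₂)⁻¹ ≡ (ψw₁ w₁⁻¹)(ψw₂ w₂⁻¹) (mod γₖ₊ₘ₊₂)`. [folklore] -/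
theorem jkm_mul {ψ : G ≃* G} (hψ : ∀ s, ψ s * s⁻¹ ∈ (⊤ : Subgroup G).lowerCentralSeries k) (m : ℕ) {w₁ w₂ : G}
    (_hw₁ : w₁ ∈ (⊤ : Subgroup G).lowerCentralSeries m) (hw₂ : w₂ ∈ (⊤ : Subgroup G).lowerCentralSeries m) :
    ((ψ (w₁ * w₂) * (w₁ * w₂)⁻¹ : G) : G ⧸ (⊤ : Subgroup G).lowerCentralSeries (k + m + 1)) =
      ((ψ w₁ * w₁⁻¹ : G) : G ⧸ (⊤ : Subgroup G).lowerCentralSeries (k + m + 1)) * (ψ w₂ * w₂⁻¹ : G) := by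
  have e : ψ (w₁ * w₂) * (w₁ * w₂)⁻¹ = (ψ w₁ * w₁⁻¹) * (w₁ * (ψ w₂ * w₂⁻¹) * w₁⁻¹) := by
    simp only [map_mul]; group
  rw [e, QuotientGroup.mk_mul, conj_quot_eq w₁ (jkm_mem ψ hψ m hw₂)]

/-- The restricted Johnson map kills `1`. [folklore] -/
theorem jkm_one (ψ : G ≃* G) (n : ℕ) :
    ((ψ 1 * 1⁻¹ : G) : G ⧸ (⊤ : Subgroup G).lowerCentralSeries n) = 1 := by
  rw [map_one, inv_one, mul_one, QuotientGroup.mk_one]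

/-- The restricted Johnson map on an inverse. [folklore] -/
theorem jkm_inv {ψ : G ≃* G} (hψ : ∀ s, ψ s * s⁻¹ ∈ (⊤ : Subgroup G).lowerCentralSeries k) (m : ℕ) {w : G}
    (hw : w ∈ (⊤ : Subgroup G).lowerCentralSeries m) :
    ((ψ w⁻¹ * w⁻¹⁻¹ : G) : G ⧸ (⊤ : Subgroup G).lowerCentralSeries (k + m + 1)) =
      ((ψ w * w⁻¹ : G) : G ⧸ (⊤ : Subgroup G).lowerCentralSeries (k + m + 1))⁻¹ := by
  have h := jkm_mul hψ m hw (inv_mem hw)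
  rw [mul_inv_cancel, jkm_one] at h
  exact eq_inv_of_mul_eq_one_right h.symm

/-- The restricted Johnson map on a power. [folklore] -/
theorem jkm_zpow {ψ : G ≃* G} (hψ : ∀ s, ψ s * s⁻¹ ∈ (⊤ : Subgroup G).lowerCentralSeries k) (m : ℕ) {w : G}
    (hw : w ∈ (⊤ : Subgroup G).lowerCentralSeries m) (n : ℤ) :
    ((ψ (w ^ n) * (w ^ n)⁻¹ : G) : G ⧸ (⊤ : Subgroup G).lowerCentralSeries (k + m + 1)) =
      ((ψ w * w⁻¹ : G) : G ⧸ (⊤ : Subgroup G).lowerCentralSeries (k + m + 1)) ^ n := by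
  induction n using Int.induction_on with
  | zero => rw [zpow_zero, zpow_zero]; exact jkm_one ψ _
  | succ n ih => rw [zpow_add_one, jkm_mul hψ m (zpow_mem hw _) hw, ih, zpow_add_one]
  | pred n ih => rw [zpow_sub_one, jkm_mul hψ m (zpow_mem hw _) (inv_mem hw), ih, jkm_inv hψ m hw, zpow_sub_one]

/-- The restricted Johnson map kills `γₘ₊₂`. [folklore] -/
theorem jkm_lcs {ψ : G ≃* G} (hψ : ∀ s, ψ s * s⁻¹ ∈ (⊤ : Subgroup G).lowerCentralSeries k) (m : ℕ) {w : G}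
    (hw : w ∈ (⊤ : Subgroup G).lowerCentralSeries (m + 1)) :
    ((ψ w * w⁻¹ : G) : G ⧸ (⊤ : Subgroup G).lowerCentralSeries (k + m + 1)) = 1 := by
  rw [QuotientGroup.eq_one_iff]
  exact jkm_mem ψ hψ (m + 1) hw

/-- **The restricted Johnson map is constant on `γₘ₊₂`-cosets.** [folklore] -/
theorem jkm_congr {ψ : G ≃* G} (hψ : ∀ s, ψ s * s⁻¹ ∈ (⊤ : Subgroup G).lowerCentralSeries k) (m : ℕ) {w₁ w₂ : G}
    (hw₂ : w₂ ∈ (⊤ : Subgroup G).lowerCentralSeries m) (h : w₁ * w₂⁻¹ ∈ (⊤ : Subgroup G).lowerCentralSeries (m + 1)) :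
    ((ψ w₁ * w₁⁻¹ : G) : G ⧸ (⊤ : Subgroup G).lowerCentralSeries (k + m + 1)) = (ψ w₂ * w₂⁻¹ : G) := by
  have e : w₁ = (w₁ * w₂⁻¹) * w₂ := by rw [inv_mul_cancel_right]
  conv_lhs => rw [e]
  rw [jkm_mul hψ m (lcs_antitone (Nat.le_succ m) h) hw₂, jkm_lcs hψ m h, one_mul]

/-- The restricted Johnson map on a product of two powers. [folklore] -/
theorem jkm_zpow_mul_zpow {ψ : G ≃* G} (hψ : ∀ s, ψ s * s⁻¹ ∈ (⊤ : Subgroup G).lowerCentralSeries k) (m : ℕ)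
    {a b : G} (ha : a ∈ (⊤ : Subgroup G).lowerCentralSeries m) (hb : b ∈ (⊤ : Subgroup G).lowerCentralSeries m)
    (p q : ℤ) :
    ((ψ (a ^ p * b ^ q) * (a ^ p * b ^ q)⁻¹ : G) : G ⧸ (⊤ : Subgroup G).lowerCentralSeries (k + m + 1)) =
      (((ψ a * a⁻¹) ^ p * (ψ b * b⁻¹) ^ q : G) : G ⧸ (⊤ : Subgroup G).lowerCentralSeries (k + m + 1)) := by
  conv_rhs => rw [QuotientGroup.mk_mul, QuotientGroup.mk_zpow, QuotientGroup.mk_zpow]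
  rw [jkm_mul hψ m (zpow_mem ha p) (zpow_mem hb q), jkm_zpow hψ m ha, jkm_zpow hψ m hb]

/-- The restricted Johnson map on a product of three powers. [folklore] -/
theorem jkm_zpow_triple {ψ : G ≃* G} (hψ : ∀ s, ψ s * s⁻¹ ∈ (⊤ : Subgroup G).lowerCentralSeries k) (m : ℕ)
    {a b c : G} (ha : a ∈ (⊤ : Subgroup G).lowerCentralSeries m) (hb : b ∈ (⊤ : Subgroup G).lowerCentralSeries m)
    (hc : c ∈ (⊤ : Subgroup G).lowerCentralSeries m) (p q r : ℤ) :
    ((ψ (a ^ p * b ^ q * c ^ r) * (a ^ p * b ^ q * c ^ r)⁻¹ : G) : G ⧸ (⊤ : Subgroup G).lowerCentralSeries (k + m + 1)) =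
      (((ψ a * a⁻¹) ^ p * (ψ b * b⁻¹) ^ q * (ψ c * c⁻¹) ^ r : G) : G ⧸ (⊤ : Subgroup G).lowerCentralSeries (k + m + 1)) := by
  conv_rhs => rw [QuotientGroup.mk_mul, QuotientGroup.mk_zpow _ (ψ c * c⁻¹)]
  rw [jkm_mul hψ m (mul_mem (zpow_mem ha p) (zpow_mem hb q)) (zpow_mem hc r), jkm_zpow_mul_zpow hψ m ha hb,
    jkm_zpow hψ m hc]

/-! ## The commutator `V = x U x⁻¹ U⁻¹` of `x ∈ 𝒥₁` and `U ∈ 𝒥₂` -/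

/-- The value of the commutator `⁅x, U⁆ = x U x⁻¹ U⁻¹` of `Aut G`. [folklore] -/
theorem commAut_apply (x U : G ≃* G) (s : G) :
    (⁅(x : MulAut G), (U : MulAut G)⁆ : MulAut G) s = x (U (x.symm (U.symm s))) := by
  rw [commutatorElement_def, MulAut.mul_apply, MulAut.mul_apply, MulAut.mul_apply, MulAut.inv_def, MulAut.inv_def]

/-- **The commutator congruence.** For `x ∈ 𝒥₁` and `U ∈ 𝒥₂` the commutator `V = x U x⁻¹ U⁻¹` lies in `𝒥₃`
and `V(s)s⁻¹ ≡ x(u)u⁻¹ · (U(ξ)ξ⁻¹)⁻¹ (mod γ₅)` where `u = U(s)s⁻¹ ∈ γ₃`, `ξ = x(s)s⁻¹ ∈ γ₂`. [folklore] -/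
theorem comm_johnson {x U : G ≃* G} (hx : ∀ s, x s * s⁻¹ ∈ (⊤ : Subgroup G).lowerCentralSeries 1)
    (hU : ∀ s, U s * s⁻¹ ∈ (⊤ : Subgroup G).lowerCentralSeries 2) (s : G) :
    (⁅(x : MulAut G), (U : MulAut G)⁆ : MulAut G) s * s⁻¹ ∈ (⊤ : Subgroup G).lowerCentralSeries 3 ∧
    (((⁅(x : MulAut G), (U : MulAut G)⁆ : MulAut G) s * s⁻¹ : G) : G ⧸ (⊤ : Subgroup G).lowerCentralSeries 4) =
      ((x (U s * s⁻¹) * (U s * s⁻¹)⁻¹ : G) : G ⧸ (⊤ : Subgroup G).lowerCentralSeries 4) *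
        (((U (x s * s⁻¹) * (x s * s⁻¹)⁻¹ : G) : G ⧸ (⊤ : Subgroup G).lowerCentralSeries 4))⁻¹ := by
  have hU1 : ∀ s, U s * s⁻¹ ∈ (⊤ : Subgroup G).lowerCentralSeries 1 := fun s => lcs_antitone (by decide) (hU s)
  obtain ⟨t, ht⟩ : ∃ t, t = x.symm (U.symm s) := ⟨_, rfl⟩
  have hs : s = U (x t) := by rw [ht, MulEquiv.apply_symm_apply, MulEquiv.apply_symm_apply]
  have hts : t * s⁻¹ ∈ (⊤ : Subgroup G).lowerCentralSeries 1 := by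
    have e : t * s⁻¹ = (x.symm (U.symm s) * (U.symm s)⁻¹) * (U.symm s * s⁻¹) := by rw [ht]; group
    rw [e]
    exact mul_mem (ia_symm hx _) (ia_symm hU1 _)
  -- the values at `t`
  have hu2 : U t * t⁻¹ ∈ (⊤ : Subgroup G).lowerCentralSeries 2 := hU t
  have hξ1 : x t * t⁻¹ ∈ (⊤ : Subgroup G).lowerCentralSeries 1 := hx t
  have hα : x (U t * t⁻¹) * (U t * t⁻¹)⁻¹ ∈ (⊤ : Subgroup G).lowerCentralSeries 3 := (jkm_mem x hx 2 hu2 :)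
  have hβ : U (x t * t⁻¹) * (x t * t⁻¹)⁻¹ ∈ (⊤ : Subgroup G).lowerCentralSeries 3 := (jkm_mem U hU 1 hξ1 :)
  have hc : ⁅U t * t⁻¹, x t * t⁻¹⁆ ∈ (⊤ : Subgroup G).lowerCentralSeries 4 := (commutator_mem_lcs hu2 hξ1 :)
  have key : (⁅(x : MulAut G), (U : MulAut G)⁆ : MulAut G) s * s⁻¹ =
      (x (U t * t⁻¹) * (U t * t⁻¹)⁻¹) * ⁅U t * t⁻¹, x t * t⁻¹⁆ * (U (x t * t⁻¹) * (x t * t⁻¹)⁻¹)⁻¹ := by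
    rw [commAut_apply, ← ht]
    conv_lhs => rw [hs]
    simp only [map_mul, map_inv, commutatorElement_def]
    group
  refine ⟨?_, ?_⟩
  · rw [key]
    exact mul_mem (mul_mem hα (lcs_antitone (show 3 ≤ 4 by decide) hc)) (inv_mem hβ)
  -- pass from `t` to `s`
  have eu : ((U t * t⁻¹ : G) : G ⧸ (⊤ : Subgroup G).lowerCentralSeries (2 + 1)) = (U s * s⁻¹ : G) := jk_quot_congr hU hts
  have eξ : ((x t * t⁻¹ : G) : G ⧸ (⊤ : Subgroup G).lowerCentralSeries (1 + 1)) = (x s * s⁻¹ : G) := jk_quot_congr hx hts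
  rw [← mul_inv_mem_iff_quot] at eu eξ
  have eα : ((x (U t * t⁻¹) * (U t * t⁻¹)⁻¹ : G) : G ⧸ (⊤ : Subgroup G).lowerCentralSeries (1 + 2 + 1)) =
      (x (U s * s⁻¹) * (U s * s⁻¹)⁻¹ : G) := jkm_congr hx 2 (hU s) eu
  have eβ : ((U (x t * t⁻¹) * (x t * t⁻¹)⁻¹ : G) : G ⧸ (⊤ : Subgroup G).lowerCentralSeries (2 + 1 + 1)) =
      (U (x s * s⁻¹) * (x s * s⁻¹)⁻¹ : G) := jkm_congr hU 1 (hx s) eξ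
  rw [show (1 + 2 + 1 : ℕ) = 4 from rfl] at eα
  rw [show (2 + 1 + 1 : ℕ) = 4 from rfl] at eβ
  rw [key, QuotientGroup.mk_mul, QuotientGroup.mk_mul, QuotientGroup.mk_inv, (QuotientGroup.eq_one_iff _).2 hc, mul_one,
    eα, eβ]

end General

/-! ## Symbols: the derivation rule and the degree-three data of commutators -/

section Symbols

variable (θ : ℕ → FreeGroup (Fin 3) → FreeLieAlgebra ℤ (Fin 3))
  (hadd : ∀ k, ∀ x ∈ (⊤ : Subgroup (FreeGroup (Fin 3))).lowerCentralSeries k,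
    ∀ y ∈ (⊤ : Subgroup (FreeGroup (Fin 3))).lowerCentralSeries k, θ k (x * y) = θ k x + θ k y)
  (hker : ∀ k, ∀ x ∈ (⊤ : Subgroup (FreeGroup (Fin 3))).lowerCentralSeries k,
    θ k x = 0 ↔ x ∈ (⊤ : Subgroup (FreeGroup (Fin 3))).lowerCentralSeries (k + 1))
  (hbr : ∀ j k, ∀ x ∈ (⊤ : Subgroup (FreeGroup (Fin 3))).lowerCentralSeries j,
    ∀ y ∈ (⊤ : Subgroup (FreeGroup (Fin 3))).lowerCentralSeries k, θ (j + k + 1) ⁅x, y⁆ = ⁅θ j x, θ k y⁆)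
  (π : SurfaceGroup 3 →* FreeGroup (Fin 3))

include hadd hker in
/-- **`θₖ ∘ π` is constant on classes modulo `γₖ₊₂`** (within `γₖ₊₁`). [folklore] -/
theorem theta_pi_congr (k : ℕ) {u v : SurfaceGroup 3} (hv : v ∈ (⊤ : Subgroup (SurfaceGroup 3)).lowerCentralSeries k)
    (h : ((u : SurfaceGroup 3) : SurfaceGroup 3 ⧸ (⊤ : Subgroup (SurfaceGroup 3)).lowerCentralSeries (k + 1)) = v) :
    θ k (π u) = θ k (π v) := by
  rw [← mul_inv_mem_iff_quot] at h
  have e : u = (u * v⁻¹) * v := by rw [inv_mul_cancel_right]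
  rw [e, map_mul]
  exact theta_mul_of_mem_succ θ hadd hker k (FreeGroupGrLie.map_mem_lcs π h) (FreeGroupGrLie.map_mem_lcs π hv)

include hadd in
/-- `θₖ ∘ π` of a product of two powers inside `γₖ₊₁`. [folklore] -/
theorem theta_pi_zpow_mul_zpow (k : ℕ) {u v : SurfaceGroup 3} (hu : u ∈ (⊤ : Subgroup (SurfaceGroup 3)).lowerCentralSeries k)
    (hv : v ∈ (⊤ : Subgroup (SurfaceGroup 3)).lowerCentralSeries k) (m n : ℤ) :
    θ k (π (u ^ m * v ^ n)) = m • θ k (π u) + n • θ k (π v) := by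
  have hu' := FreeGroupGrLie.map_mem_lcs π hu
  have hv' := FreeGroupGrLie.map_mem_lcs π hv
  rw [map_mul, map_zpow, map_zpow, hadd k _ (zpow_mem hu' m) _ (zpow_mem hv' n), theta_zpow θ hadd k hu',
    theta_zpow θ hadd k hv']

include hadd in
/-- `θₖ ∘ π` of a product of three powers inside `γₖ₊₁`. [folklore] -/
theorem theta_pi_zpow_triple (k : ℕ) {u v w : SurfaceGroup 3} (hu : u ∈ (⊤ : Subgroup (SurfaceGroup 3)).lowerCentralSeries k)
    (hv : v ∈ (⊤ : Subgroup (SurfaceGroup 3)).lowerCentralSeries k) (hw : w ∈ (⊤ : Subgroup (SurfaceGroup 3)).lowerCentralSeries k)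
    (m n p : ℤ) :
    θ k (π (u ^ m * v ^ n * w ^ p)) = m • θ k (π u) + n • θ k (π v) + p • θ k (π w) := by
  have hw' := FreeGroupGrLie.map_mem_lcs π hw
  rw [map_mul, map_zpow π w, hadd k _ (FreeGroupGrLie.map_mem_lcs π (mul_mem (zpow_mem hu m) (zpow_mem hv n))) _ (zpow_mem hw' p),
    theta_pi_zpow_mul_zpow θ hadd π k hu hv, theta_zpow θ hadd k hw']

include hadd hker hbr in
/-- **The derivation rule for the symbols.** For `c ∈ γⱼ₊₁`, `f ∈ γⱼ₊ₘ₊₁`, `p ∈ γₖ₊₁`, `e ∈ γₖ₊ₘ₊₁` (`1 ≤ m`) the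
quotient `⁅f c, e p⁆ ⁅c, p⁆⁻¹` lies in `γ_{j+k+m+2}` with symbol `⁅θⱼ c, θₖ₊ₘ e⁆ + ⁅θⱼ₊ₘ f, θₖ p⁆` (exact identity
`⁅fc, ep⁆⁅c,p⁆⁻¹ = ⁅f, Y⁆ ⁅c,e⁆ ⁅e,⁅c,p⁆⁆ ⁅⁅c,p⁆,⁅f,ep⁆⁆ ⁅f, ep⁆`, `Y = ⁅c,e⁆⁅e,⁅c,p⁆⁆⁅c,p⁆`, whose first, third and
fourth factors are one step deeper). [folklore] -/
theorem theta_expand (j k m : ℕ) (hm : 1 ≤ m) {c f p e : FreeGroup (Fin 3)}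
    (hc : c ∈ (⊤ : Subgroup (FreeGroup (Fin 3))).lowerCentralSeries j)
    (hf : f ∈ (⊤ : Subgroup (FreeGroup (Fin 3))).lowerCentralSeries (j + m))
    (hp : p ∈ (⊤ : Subgroup (FreeGroup (Fin 3))).lowerCentralSeries k)
    (he : e ∈ (⊤ : Subgroup (FreeGroup (Fin 3))).lowerCentralSeries (k + m)) :
    ⁅f * c, e * p⁆ * (⁅c, p⁆)⁻¹ ∈ (⊤ : Subgroup (FreeGroup (Fin 3))).lowerCentralSeries (j + k + m + 1) ∧
    θ (j + k + m + 1) (⁅f * c, e * p⁆ * (⁅c, p⁆)⁻¹) = ⁅θ j c, θ (k + m) e⁆ + ⁅θ (j + m) f, θ k p⁆ := by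
  have key : ⁅f * c, e * p⁆ * (⁅c, p⁆)⁻¹ =
      ⁅f, ⁅c, e⁆ * ⁅e, ⁅c, p⁆⁆ * ⁅c, p⁆⁆ * ⁅c, e⁆ * ⁅e, ⁅c, p⁆⁆ * ⁅⁅c, p⁆, ⁅f, e * p⁆⁆ * ⁅f, e * p⁆ := by
    simp only [commutatorElement_def]; group
  have hep : e * p ∈ (⊤ : Subgroup (FreeGroup (Fin 3))).lowerCentralSeries k :=
    mul_mem (lcs_antitone (Nat.le_add_right k m) he) hp
  have hA : ⁅c, e⁆ ∈ (⊤ : Subgroup (FreeGroup (Fin 3))).lowerCentralSeries (j + k + m + 1) :=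
    commutator_mem_lcs_of_eq (by omega) hc he
  have hB : ⁅c, p⁆ ∈ (⊤ : Subgroup (FreeGroup (Fin 3))).lowerCentralSeries (j + k + 1) := (commutator_mem_lcs hc hp :)
  have hC : ⁅f, e * p⁆ ∈ (⊤ : Subgroup (FreeGroup (Fin 3))).lowerCentralSeries (j + k + m + 1) :=
    commutator_mem_lcs_of_eq (by omega) hf hep
  have heB : ⁅e, ⁅c, p⁆⁆ ∈ (⊤ : Subgroup (FreeGroup (Fin 3))).lowerCentralSeries (j + k + m + 1 + 1) :=
    lcs_antitone (show j + k + m + 1 + 1 ≤ (k + m) + (j + k + 1) + 1 by omega) (commutator_mem_lcs he hB)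
  have hY : ⁅c, e⁆ * ⁅e, ⁅c, p⁆⁆ * ⁅c, p⁆ ∈ (⊤ : Subgroup (FreeGroup (Fin 3))).lowerCentralSeries (j + k + 1) :=
    mul_mem (mul_mem (lcs_antitone (by omega) hA) (lcs_antitone (by omega) heB)) hB
  have hfY : ⁅f, ⁅c, e⁆ * ⁅e, ⁅c, p⁆⁆ * ⁅c, p⁆⁆ ∈ (⊤ : Subgroup (FreeGroup (Fin 3))).lowerCentralSeries (j + k + m + 1 + 1) :=
    lcs_antitone (show j + k + m + 1 + 1 ≤ (j + m) + (j + k + 1) + 1 by omega) (commutator_mem_lcs hf hY)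
  have hBC : ⁅⁅c, p⁆, ⁅f, e * p⁆⁆ ∈ (⊤ : Subgroup (FreeGroup (Fin 3))).lowerCentralSeries (j + k + m + 1 + 1) :=
    lcs_antitone (show j + k + m + 1 + 1 ≤ (j + k + 1) + (j + k + m + 1) + 1 by omega) (commutator_mem_lcs hB hC)
  have hle : j + k + m + 1 ≤ j + k + m + 1 + 1 := Nat.le_succ _
  have h1 : ⁅f, ⁅c, e⁆ * ⁅e, ⁅c, p⁆⁆ * ⁅c, p⁆⁆ * ⁅c, e⁆ ∈ (⊤ : Subgroup (FreeGroup (Fin 3))).lowerCentralSeries (j + k + m + 1) :=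
    mul_mem (lcs_antitone hle hfY) hA
  have h2 : ⁅f, ⁅c, e⁆ * ⁅e, ⁅c, p⁆⁆ * ⁅c, p⁆⁆ * ⁅c, e⁆ * ⁅e, ⁅c, p⁆⁆ ∈
      (⊤ : Subgroup (FreeGroup (Fin 3))).lowerCentralSeries (j + k + m + 1) := mul_mem h1 (lcs_antitone hle heB)
  have h3 : ⁅f, ⁅c, e⁆ * ⁅e, ⁅c, p⁆⁆ * ⁅c, p⁆⁆ * ⁅c, e⁆ * ⁅e, ⁅c, p⁆⁆ * ⁅⁅c, p⁆, ⁅f, e * p⁆⁆ ∈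
      (⊤ : Subgroup (FreeGroup (Fin 3))).lowerCentralSeries (j + k + m + 1) := mul_mem h2 (lcs_antitone hle hBC)
  refine ⟨by rw [key]; exact mul_mem h3 hC, ?_⟩
  have eA := hbr j (k + m) c hc e he
  rw [show j + (k + m) + 1 = j + k + m + 1 by omega] at eA
  have eC := hbr (j + m) k f hf (e * p) hep
  rw [show j + m + k + 1 = j + k + m + 1 by omega, hadd k e (lcs_antitone (Nat.le_add_right k m) he) p hp,
    (hker k e (lcs_antitone (Nat.le_add_right k m) he)).2 (lcs_antitone (by omega) he), zero_add] at eC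
  rw [key, hadd _ _ h3 _ hC, hadd _ _ h2 _ (lcs_antitone hle hBC), hadd _ _ h1 _ (lcs_antitone hle heB),
    hadd _ _ (lcs_antitone hle hfY) _ hA, (hker _ _ (lcs_antitone hle hfY)).2 hfY, (hker _ _ (lcs_antitone hle heB)).2 heB,
    (hker _ _ (lcs_antitone hle hBC)).2 hBC, eA, eC, zero_add, add_zero, add_zero]

include hadd hker hbr in
/-- **The degree-three datum of `x(⁅⁅P,Q⁆,R⁆) ⁅⁅P,Q⁆,R⁆⁻¹` for `x ∈ 𝒥₁`**: the derivation rule applied to the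
degree-one data `θ₁(π(x(·)(·)⁻¹))` of `x` at `P, Q, R`. [folklore] -/
theorem theta3_x_comm_comm {x : SurfaceGroup 3 ≃* SurfaceGroup 3}
    (hx : ∀ s, x s * s⁻¹ ∈ (⊤ : Subgroup (SurfaceGroup 3)).lowerCentralSeries 1) (P Q R : SurfaceGroup 3) :
    x ⁅⁅P, Q⁆, R⁆ * (⁅⁅P, Q⁆, R⁆)⁻¹ ∈ (⊤ : Subgroup (SurfaceGroup 3)).lowerCentralSeries 3 ∧
    θ 3 (π (x ⁅⁅P, Q⁆, R⁆ * (⁅⁅P, Q⁆, R⁆)⁻¹)) =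
      ⁅⁅θ 0 (π P), θ 0 (π Q)⁆, θ 1 (π (x R * R⁻¹))⁆ +
        ⁅⁅θ 0 (π P), θ 1 (π (x Q * Q⁻¹))⁆ + ⁅θ 1 (π (x P * P⁻¹)), θ 0 (π Q)⁆, θ 0 (π R)⁆ := by
  have hD : ⁅⁅P, Q⁆, R⁆ ∈ (⊤ : Subgroup (SurfaceGroup 3)).lowerCentralSeries 2 :=
    commutator_mem_commutator (commutator_mem_commutator (mem_top P) (mem_top Q)) (mem_top R)
  refine ⟨(jkm_mem x hx 2 hD :), ?_⟩
  obtain ⟨eP, heP⟩ : ∃ eP, eP = x P * P⁻¹ := ⟨_, rfl⟩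
  obtain ⟨eQ, heQ⟩ : ∃ eQ, eQ = x Q * Q⁻¹ := ⟨_, rfl⟩
  obtain ⟨eR, heR⟩ : ∃ eR, eR = x R * R⁻¹ := ⟨_, rfl⟩
  have hxP : x P = eP * P := by rw [heP, inv_mul_cancel_right]
  have hxQ : x Q = eQ * Q := by rw [heQ, inv_mul_cancel_right]
  have hxR : x R = eR * R := by rw [heR, inv_mul_cancel_right]
  have h1P : π eP ∈ (⊤ : Subgroup (FreeGroup (Fin 3))).lowerCentralSeries (0 + 1) := by
    rw [heP]; exact FreeGroupGrLie.map_mem_lcs π (hx P)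
  have h1Q : π eQ ∈ (⊤ : Subgroup (FreeGroup (Fin 3))).lowerCentralSeries (0 + 1) := by
    rw [heQ]; exact FreeGroupGrLie.map_mem_lcs π (hx Q)
  have h1R : π eR ∈ (⊤ : Subgroup (FreeGroup (Fin 3))).lowerCentralSeries (0 + 1) := by
    rw [heR]; exact FreeGroupGrLie.map_mem_lcs π (hx R)
  rw [← heP, ← heQ, ← heR, map_commutatorElement, map_commutatorElement, hxP, hxQ, hxR]
  simp only [map_mul, map_inv, map_commutatorElement]
  -- inner expansion
  obtain ⟨hin1, hin2⟩ := theta_expand θ hadd hker hbr 0 0 1 le_rfl (mem_top (π P)) h1P (mem_top (π Q)) h1Q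
  have eF : ⁅π eP * π P, π eQ * π Q⁆ = (⁅π eP * π P, π eQ * π Q⁆ * (⁅π P, π Q⁆)⁻¹) * ⁅π P, π Q⁆ := by
    rw [inv_mul_cancel_right]
  have hc1 : ⁅π P, π Q⁆ ∈ (⊤ : Subgroup (FreeGroup (Fin 3))).lowerCentralSeries 1 :=
    commutator_mem_commutator (mem_top _) (mem_top _)
  rw [show (0 + 0 + 1 + 1 : ℕ) = 1 + 1 from rfl] at hin1 hin2
  obtain ⟨-, hout⟩ := theta_expand θ hadd hker hbr 1 0 1 le_rfl hc1 hin1 (mem_top (π R)) h1R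
  rw [eF, hout, hin2]
  have e2 := hbr 0 0 (π P) (mem_top _) (π Q) (mem_top _)
  rw [show (0 + 0 + 1 : ℕ) = 1 from rfl] at e2
  rw [e2]

include hadd hker hbr in
/-- **The degree-three datum of `U(⁅A,B⁆) ⁅A,B⁆⁻¹` for `U ∈ 𝒥₂`**: `⁅θ₀(πA), θ₂(π(U(B)B⁻¹))⁆ + ⁅θ₂(π(U(A)A⁻¹)), θ₀(πB)⁆`.
[folklore] -/
theorem theta3_U_comm {U : SurfaceGroup 3 ≃* SurfaceGroup 3}
    (hU : ∀ s, U s * s⁻¹ ∈ (⊤ : Subgroup (SurfaceGroup 3)).lowerCentralSeries 2) (A B : SurfaceGroup 3) :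
    U ⁅A, B⁆ * (⁅A, B⁆)⁻¹ ∈ (⊤ : Subgroup (SurfaceGroup 3)).lowerCentralSeries 3 ∧
    θ 3 (π (U ⁅A, B⁆ * (⁅A, B⁆)⁻¹)) = ⁅θ 0 (π A), θ 2 (π (U B * B⁻¹))⁆ + ⁅θ 2 (π (U A * A⁻¹)), θ 0 (π B)⁆ := by
  have hD : ⁅A, B⁆ ∈ (⊤ : Subgroup (SurfaceGroup 3)).lowerCentralSeries 1 :=
    commutator_mem_commutator (mem_top A) (mem_top B)
  refine ⟨(jkm_mem U hU 1 hD :), ?_⟩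
  obtain ⟨eA, heA⟩ : ∃ eA, eA = U A * A⁻¹ := ⟨_, rfl⟩
  obtain ⟨eB, heB⟩ : ∃ eB, eB = U B * B⁻¹ := ⟨_, rfl⟩
  have hUA : U A = eA * A := by rw [heA, inv_mul_cancel_right]
  have hUB : U B = eB * B := by rw [heB, inv_mul_cancel_right]
  have h2A : π eA ∈ (⊤ : Subgroup (FreeGroup (Fin 3))).lowerCentralSeries (0 + 2) := by
    rw [heA]; exact FreeGroupGrLie.map_mem_lcs π (hU A)
  have h2B : π eB ∈ (⊤ : Subgroup (FreeGroup (Fin 3))).lowerCentralSeries (0 + 2) := by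
    rw [heB]; exact FreeGroupGrLie.map_mem_lcs π (hU B)
  rw [← heA, ← heB, map_commutatorElement, hUA, hUB]
  simp only [map_mul, map_inv, map_commutatorElement]
  obtain ⟨-, h⟩ := theta_expand θ hadd hker hbr 0 0 2 (by decide) (mem_top (π A)) h2A (mem_top (π B)) h2B
  rw [h]

end Symbols


end LayerZeroTwo

/-- **Registered helper `helper_layerZeroTwoCommJohnson`** (sub-goal of stub `stub_layerStepZeroTwo`, item
stmt-SmoothPoincare4-14595): the commutator congruence `V(s)s⁻¹ ≡ x(u)u⁻¹ (U(ξ)ξ⁻¹)⁻¹ (mod γ₅)` for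
`V = x U x⁻¹ U⁻¹`, `x ∈ 𝒥₁`, `U ∈ 𝒥₂` of `S₃`, in closed form. [folklore] -/
theorem helper_layerZeroTwoCommJohnson : ∀ (x U : Literature.Topology.FourManifolds.SurfaceGroup 3 ≃* Literature.Topology.FourManifolds.SurfaceGroup 3), (∀ s : Literature.Topology.FourManifolds.SurfaceGroup 3, x s * s⁻¹ ∈ (⊤ : Subgroup (Literature.Topology.FourManifolds.SurfaceGroup 3)).lowerCentralSeries 1) → (∀ s : Literature.Topology.FourManifolds.SurfaceGroup 3, U s * s⁻¹ ∈ (⊤ : Subgroup (Literature.Topology.FourManifolds.SurfaceGroup 3)).lowerCentralSeries 2) → ∀ s : Literature.Topology.FourManifolds.SurfaceGroup 3, x (U (x.symm (U.symm s))) * s⁻¹ ∈ (⊤ : Subgroup (Literature.Topology.FourManifolds.SurfaceGroup 3)).lowerCentralSeries 3 ∧ ((x (U (x.symm (U.symm s))) * s⁻¹ : Literature.Topology.FourManifolds.SurfaceGroup 3) : Literature.Topology.FourManifolds.SurfaceGroup 3 ⧸ (⊤ : Subgroup (Literature.Topology.FourManifolds.SurfaceGroup 3)).lowerCentralSeries 4)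 = ((x (U s * s⁻¹) * (U s * s⁻¹)⁻¹ : Literature.Topology.FourManifolds.SurfaceGroup 3) : Literature.Topology.FourManifolds.SurfaceGroup 3 ⧸ (⊤ : Subgroup (Literature.Topology.FourManifolds.SurfaceGroup 3)).lowerCentralSeries 4) * (((U (x s * s⁻¹) * (x s * s⁻¹)⁻¹ : Literature.Topology.FourManifolds.SurfaceGroup 3) : Literature.Topology.FourManifolds.SurfaceGroup 3 ⧸ (⊤ : Subgroup (Literature.Topology.FourManifolds.SurfaceGroup 3)).lowerCentralSeries 4))⁻¹ :=
  fun x U hx hU s => by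
    have h := LayerZeroTwo.comm_johnson hx hU s
    rw [LayerZeroTwo.commAut_apply] at h
    exact h

end Summit.SmoothPoincare4.SmoothPoincare4.Theorems.ShadowApproximation.NilpotentGenusClass

end
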